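import Summits.Langlands.Langlands.Theorems.ParityBlindBianchiResidualBianchiDoorMod2ReducibleSolvable
import Literature.NumberTheory.GaloisRepresentations.GaloisRep
import HarnessLib

/-!
# `TwoAdicBianchiProModularityLevel` (crux stmt-Langlands-15110, route `ParityBlindBianchi`),
# negative side — hypothesis mutation: the irreducibility hypothesis is redundant

The crux quantifies over `σ : FramedGaloisRep K (PadicAlgCl 2) 2` with `Finite σ.toMonoidHom.range`,
`σ.toGaloisRep.IsIrreducible` and projective image `≅ A₅`.  Recorded here, sorry-free
(refuter cdisprove seat, cycle 1): the second hypothesis is implied by the third, over ANY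
coefficient field and without finiteness — a reducible two-dimensional representation over a field
has image conjugate into the Borel subgroup, hence solvable image (tree:
`isSolvable_range_of_not_isIrreducible`), while a representation of icosahedral type has
non-solvable image (`IsIcosahedralType.not_isSolvable_range`, `A₅` simple non-abelian).

Moral for provers and planners: `TwoAdicBianchiProModularityLevel` is equivalent to the same
statement with `σ.toGaloisRep.IsIrreducible` deleted ("hIrr unnecessary"); no proof can extract from
irreducibility anything the `A₅` hypothesis does not already give.  This file does NOT refute the
crux.
-/

noncomputable section

set_option linter.dupNamespace false

namespace Summit.Langlands.Langlands.Theorems.TwoAdicBianchiProModularityLevel.Negative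

open Literature.NumberTheory.GaloisRepresentations

/-- **`hIrr` is redundant.**  A framed two-dimensional Galois representation over a field whose
projective image is `≅ A₅` is irreducible. [folklore] -/
theorem isIrreducible_of_projectiveImage_alternatingGroup_five {K : Type} [Field K]
    {A : Type} [Field A] [TopologicalSpace A] [IsTopologicalRing A]
    (σ : FramedGaloisRep K A 2)
    (hA5 : Nonempty ((Matrix.ProjGenLinGroup.mk.comp σ.toMonoidHom).range ≃*
      alternatingGroup (Fin 5))) :
    σ.toGaloisRep.IsIrreducible := by
  by_contra h
  exact IsIcosahedralType.not_isSolvable_range (ρ := σ.toMonoidHom) hA5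
    (Summit.Langlands.Langlands.Theorems.ResidualBianchiDoorMod2.isSolvable_range_of_not_isIrreducible
      σ.toMonoidHom h)

/-- The same for the crux's coefficients `ℚ̄₂ = PadicAlgCl 2`, in the exact shape of the crux's
hypotheses: `Finite σ.toMonoidHom.range` is not even needed. [folklore] -/
theorem isIrreducible_of_icosahedral_padicAlgCl {K : Type} [Field K] [NumberField K]
    (σ : FramedGaloisRep K (PadicAlgCl 2) 2)
    (hA5 : Nonempty ((Matrix.ProjGenLinGroup.mk.comp σ.toMonoidHom).range ≃*
      alternatingGroup (Fin 5))) :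
    σ.toGaloisRep.IsIrreducible :=
  isIrreducible_of_projectiveImage_alternatingGroup_five σ hA5

end Summit.Langlands.Langlands.Theorems.TwoAdicBianchiProModularityLevel.Negative

end
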